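import Summits.ResolutionOfSingularities.ResolutionOfSingularities.Theorems.PurelyInseparableDim4ChartAtlasSNCGoodShear
import Literature.AlgebraicGeometry.Resolution.BlowupSequencesBoundarySuperset
import Literature.AlgebraicGeometry.Resolution.StrictTransformBaseChange
import HarnessLib

/-!
# Purely inseparable four-folds `z^p + F(x₁, …, x₄)`: FAR old members are harmless when the next centre stays inside the
# exceptional divisor (`j ∈ S'`) — the good cases of S3-N2 with near AND far boundary (cell `res-dim4-pi`, typ-2 g5)

[OURS · counted 0] (D-0157 DOOR 2; DR-157-C). The positive side of the S3-N2 dichotomy on `W` (p697935 `…_of_good`, p698330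
`…_of_good_shear`) assumed a NEAR old boundary (`cᵢ = 0` on `S`). Far old members `{xᵢ = -dᵢ}` (`i ∈ S`, `dᵢ ≠ 0`) can resonate when
the next centre ESCAPES (`j ∉ S'`; p699206, p699584). PROVED here (no `sorry`, no new axiom): when `j ∈ S'` they are harmless —
* `support_globalCentre_subset_support_exceptional` — `j ∈ S'` ⟹ `V(Zc) ⊆ E₁ = π⁻¹ V(z, x_S)`;
* `support_strictTransform_far_inter_support_globalCentre` — hence the strict transform of a far member MISSES `V(Zc)`;
* **`hasSNCWith_transform_boundary_globalCentre_of_good_far`** — `j ∈ S'`, old boundary `[(xᵢ + cᵢ)·𝒪 : i ∈ ms] ++ [(xᵢ + dᵢ)·𝒪 : i ∈ fs]`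
  with `c = 0` on `S` (near), `i ∈ S ∧ dᵢ ≠ 0` on `fs` (far), `fs ∩ ms = ∅` (one member per index), near GOODNESS
  `∀ i ∈ ms, i ∈ S → i ∈ S' → i ≠ j → bᵢ = 0` ⟹ `HasSNCWith M'.boundary Zc` (tree `HasSNCWith.of_disjoint` over p697935);
* **`hasSNCWith_transform_boundary_globalCentre_of_good_shear_far`** — the same over the second good case (p698330).
So for `j ∈ S'` the near criterion `|B| ≤ 1` is the COMPLETE W-level positive statement for index-distinct old boundaries; for `j ∉ S'`
the far heights enter (memo S3-N2-SNC-CRITERION.md §05:30Z). Nothing here is a statement about resolution of singularities in dimension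
≥ 4 / characteristic `p` (NOT proved anywhere in this programme). bears_on: LADDER-RESOLUTION:D157-DOOR2 (res-dim4-pi). Supports
stmt-ResolutionOfSingularities-16155 (helper).
-/

-- every declaration of this summit lives under `Summit.ResolutionOfSingularities.ResolutionOfSingularities`
-- (summit = problem), which the duplicate-namespace linter flags; house convention (cf. the Target file).
set_option linter.dupNamespace false

noncomputable section

open MvPolynomial Finset CategoryTheory AlgebraicGeometry Opposite TopologicalSpace
open AlgebraicGeometry.Scheme.IdealSheafData (ofIdealTop vanishingIdeal)

namespace Summit.ResolutionOfSingularities.ResolutionOfSingularities.Theorems.PIDim4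

open Literature.AlgebraicGeometry.Resolution
open Literature.AlgebraicGeometry.Resolution.Hauser2010
open Literature.AlgebraicGeometry.Resolution.AffinePointBlowup (P A γ coord Wtop ξ)
open Literature.Barriers.ResolutionOfSingularities

namespace ChartDictionary

section Support

variable {K : Type} [Field K] {S S' : Finset (Fin 4)} {j : Fin 4} {b : Fin 4 → K} {Θⱼ : A 4 K ≃ₐ[K] A 4 K}
  {W : Scheme.{0}} {π : W ⟶ P 4 K}

/-! ## §1 For `j ∈ S'` the global centre stays inside the exceptional divisor -/

/-- **`j ∈ S'` ⟹ `V(Zc) ⊆ E₁`**: the chart centre `V(y_0, y_{S'})` lies in `{y_j = 0}` = `E₁` on the re-centred chart (`b_j = 0`), and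
`E₁` is closed. -/
theorem support_globalCentre_subset_support_exceptional (hj : j ∈ S) (hjS' : j ∈ S') (hbj : b j = 0)
    (hsj : ∀ i : Fin 4, Θⱼ (X i.succ) = X i.succ + C (b i))
    (hπ : IsBlowup π (AffineCoordBlowup.𝓘Λ 4 K (insert 0 (Fin.succ '' (S : Set (Fin 4)))))) :
    haveI : IsIso (CommRingCat.ofHom (Θⱼ : A 4 K →+* A 4 K)) := (inferInstance : IsIso Θⱼ.toRingEquiv.toCommRingCatIso.hom)
    ((vanishingIdeal (closureImage
        (Spec.map (CommRingCat.ofHom (Θⱼ : A 4 K →+* A 4 K)) ≫ AffineCoordBlowup.chartImm hπ (succ_mem_centreVars hj))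
        ((AffineCoordBlowup.𝓘Λ 4 K (insert 0 (Fin.succ '' (S' : Set (Fin 4))))).support : Set (P 4 K)))).support : Set W) ⊆
      ((AffineCoordBlowup.𝓘Λ 4 K (insert 0 (Fin.succ '' (S : Set (Fin 4))))).comap π).support := by
  haveI : IsIso (CommRingCat.ofHom (Θⱼ : A 4 K →+* A 4 K)) := (inferInstance : IsIso Θⱼ.toRingEquiv.toCommRingCatIso.hom)
  set φⱼ := Spec.map (CommRingCat.ofHom (Θⱼ : A 4 K →+* A 4 K)) ≫ AffineCoordBlowup.chartImm hπ (succ_mem_centreVars hj) with hφⱼ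
  set E₁ := (AffineCoordBlowup.𝓘Λ 4 K (insert 0 (Fin.succ '' (S : Set (Fin 4))))).comap π with hE₁
  rw [Scheme.IdealSheafData.coe_support_vanishingIdeal, coe_closureImage, AffineCoordBlowup.support_𝓘Λ]
  refine closure_minimal ?_ E₁.support.isClosed
  rintro _ ⟨y, hy, rfl⟩
  have hread : E₁.comap φⱼ = ofIdealTop (Ideal.span {(γ 4 K).symm (X j.succ)}) := by
    rw [hE₁, hφⱼ, Scheme.IdealSheafData.comap_comp, comap_𝓘Λ_chartImm hj hπ,
      show coord 4 K j.succ = (γ 4 K).symm (X j.succ) from rfl, comap_ofIdealTop_span_γ_symm, RingHom.coe_coe, hsj j, hbj,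
      C_0, add_zero]
  have hy' : y ∈ ((E₁.comap φⱼ).support : Set (P 4 K)) := by
    rw [hread, SetLike.mem_coe, ofIdealTop_span_γ_symm_eq_shf,
      Literature.AlgebraicGeometry.Hironaka2017.SpecOrders.mem_support_shf_iff, Ideal.span_singleton_le_iff_mem]
    exact (AffineCoordBlowup.mem_CΛ_iff' 4 K _ y).mp hy _ (Set.mem_insert_of_mem _ ⟨j, Finset.mem_coe.mpr hjS', rfl⟩)
  rw [Scheme.IdealSheafData.support_comap] at hy'
  exact hy'

/-- **The strict transform of a FAR member misses `V(Zc)` when `j ∈ S'`**: `V(St{xᵢ = -d}) ⊆ π⁻¹{xᵢ = -d}`, `V(Zc) ⊆ π⁻¹V(z, x_S)`, and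
`{xᵢ = -d} ∩ V(z, x_S) = ∅` for `i ∈ S`, `d ≠ 0`. -/
theorem support_strictTransform_far_inter_support_globalCentre (hj : j ∈ S) (hjS' : j ∈ S') (hbj : b j = 0)
    (hsj : ∀ i : Fin 4, Θⱼ (X i.succ) = X i.succ + C (b i))
    (hπ : IsBlowup π (AffineCoordBlowup.𝓘Λ 4 K (insert 0 (Fin.succ '' (S : Set (Fin 4)))))) {i : Fin 4} (hi : i ∈ S)
    {d : K} (hd : d ≠ 0) :
    haveI : IsIso (CommRingCat.ofHom (Θⱼ : A 4 K →+* A 4 K)) := (inferInstance : IsIso Θⱼ.toRingEquiv.toCommRingCatIso.hom)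
    ((strictTransformIdeal π (AffineCoordBlowup.𝓘Λ 4 K (insert 0 (Fin.succ '' (S : Set (Fin 4)))))
        (ofIdealTop (Ideal.span {(γ 4 K).symm (X i.succ + C d)}))).support : Set W) ∩
      (vanishingIdeal (closureImage
        (Spec.map (CommRingCat.ofHom (Θⱼ : A 4 K →+* A 4 K)) ≫ AffineCoordBlowup.chartImm hπ (succ_mem_centreVars hj))
        ((AffineCoordBlowup.𝓘Λ 4 K (insert 0 (Fin.succ '' (S' : Set (Fin 4))))).support : Set (P 4 K)))).support = ∅ := by
  haveI : IsIso (CommRingCat.ofHom (Θⱼ : A 4 K →+* A 4 K)) := (inferInstance : IsIso Θⱼ.toRingEquiv.toCommRingCatIso.hom)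
  rw [← Set.disjoint_iff_inter_eq_empty, Set.disjoint_left]
  intro w hw hwZ
  have hwD : w ∈ (((ofIdealTop (Ideal.span {(γ 4 K).symm (X i.succ + C d)})).comap π).support : Set W) :=
    Scheme.IdealSheafData.support_antitone (comap_le_strictTransformIdeal π _ _) hw
  have hwE := support_globalCentre_subset_support_exceptional hj hjS' hbj hsj hπ hwZ
  rw [SetLike.mem_coe, Scheme.IdealSheafData.support_comap] at hwD hwE
  have hdisj := disjoint_support_translate_CΛ' (K := K) (Λ := insert 0 (Fin.succ '' (S : Set (Fin 4)))) (i := i.succ)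
    (Set.mem_insert_of_mem _ ⟨i, Finset.mem_coe.mpr hi, rfl⟩) hd
  rw [← AffineCoordBlowup.support_𝓘Λ] at hdisj
  exact Set.disjoint_left.mp hdisj hwD hwE

end Support

/-! ## §2 The good cases with near and far old members, `j ∈ S'` -/

variable {K : Type} [Field K] {p : ℕ} [hp : Fact p.Prime] [CharP K p]
  {S S' : Finset (Fin 4)} {j m : Fin 4} {b : Fin 4 → K} {Θⱼ : A 4 K ≃ₐ[K] A 4 K} {h : MvPolynomial (Fin 4) K}
  {F F₁ : MvPolynomial (Fin 4) K} {W : Scheme.{0}} {π : W ⟶ P 4 K}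

/-- The mixed old boundary (near members on `ms`, far members on `fs`, one member per index) has snc with the centre `V(z, x_S)`. -/
theorem hasSNCWith_nearFar_𝓘Λ (ms fs : List (Fin 4)) (c d : Fin 4 → K) (hdis : ∀ i ∈ fs, i ∉ ms) (j : Fin 4) :
    HasSNCWith ((ms.map fun i => ofIdealTop (Ideal.span {(γ 4 K).symm (X i.succ + C (c i))})) ++
        fs.map fun i => ofIdealTop (Ideal.span {(γ 4 K).symm (X i.succ + C (d i))}))
      (AffineCoordBlowup.𝓘Λ 4 K (insert 0 (Fin.succ '' (S : Set (Fin 4))))) := by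
  classical
  let c5 : Fin (4 + 1) → K := Fin.cases 0 fun i => if i ∈ fs then d i else c i
  have hc5 : ∀ i : Fin 4, c5 i.succ = if i ∈ fs then d i else c i := fun i => rfl
  refine hasSNCWith_𝓘Λ_of_forall_mem_shape (K := K) (T := S) (j := j) (β := fun _ => (0 : K)) (c := c5) rfl (fun _ _ => rfl)
    rfl fun D hD => ?_
  right
  rcases List.mem_append.mp hD with hD | hD
  · obtain ⟨i, hi, rfl⟩ := List.mem_map.mp hD
    refine ⟨i.succ, ?_⟩
    rw [hc5, if_neg (fun h' => hdis i h' hi), C_0, zero_mul, add_zero]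
  · obtain ⟨i, hi, rfl⟩ := List.mem_map.mp hD
    refine ⟨i.succ, ?_⟩
    rw [hc5, if_pos hi, C_0, zero_mul, add_zero]

/-- **GOOD CASE WITH FAR MEMBERS (`j ∈ S'`).** As `hasSNCWith_transform_boundary_globalCentre_of_good`, the old boundary now being
`[(xᵢ + cᵢ)·𝒪 : i ∈ ms] ++ [(xᵢ + dᵢ)·𝒪 : i ∈ fs]` with far members `i ∈ S`, `dᵢ ≠ 0` on `fs`, `fs ∩ ms = ∅`; near goodness on `ms`. -/
theorem hasSNCWith_transform_boundary_globalCentre_of_good_far [IsAlgClosed K] (hj : j ∈ S) (hjS' : j ∈ S') (hbj : b j = 0)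
    (hF : F ≠ 0) (hclean : HauserPerlega.IsClean p F) (h0j : Θⱼ (X 0) = X 0 + rename Fin.succ h)
    (hsj : ∀ i : Fin 4, Θⱼ (X i.succ) = X i.succ + C (b i))
    (hπ : IsBlowup π (AffineCoordBlowup.𝓘Λ 4 K (insert 0 (Fin.succ '' (S : Set (Fin 4))))))
    (hperm : (p : ℕ∞) ≤ CentreBlowup.ordAlong S F)
    (hread : Θⱼ (coordBlowupSubst K (insert 0 (Fin.succ '' (S : Set (Fin 4)))) j.succ (hyp p F)) = X j.succ ^ p * hyp p F₁)
    (hperm' : (p : ℕ∞) ≤ CentreBlowup.ordAlong S' F₁) (ms fs : List (Fin 4)) (c d : Fin 4 → K) (hc : ∀ i ∈ S, c i = 0)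
    (hfs : ∀ i ∈ fs, i ∈ S ∧ d i ≠ 0) (hdis : ∀ i ∈ fs, i ∉ ms) (hgood : ∀ i ∈ ms, i ∈ S → i ∈ S' → i ≠ j → b i = 0) :
    haveI : IsIso (CommRingCat.ofHom (Θⱼ : A 4 K →+* A 4 K)) := (inferInstance : IsIso Θⱼ.toRingEquiv.toCommRingCatIso.hom)
    HasSNCWith
      ((⟨hypSheaf p F, (ms.map fun i => ofIdealTop (Ideal.span {(γ 4 K).symm (X i.succ + C (c i))})) ++
          fs.map fun i => ofIdealTop (Ideal.span {(γ 4 K).symm (X i.succ + C (d i))}), p⟩ :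
          MarkedIdeal (P 4 K)).transform π (AffineCoordBlowup.𝓘Λ 4 K (insert 0 (Fin.succ '' (S : Set (Fin 4)))))).boundary
      (vanishingIdeal (closureImage
        (Spec.map (CommRingCat.ofHom (Θⱼ : A 4 K →+* A 4 K)) ≫ AffineCoordBlowup.chartImm hπ (succ_mem_centreVars hj))
        ((AffineCoordBlowup.𝓘Λ 4 K (insert 0 (Fin.succ '' (S' : Set (Fin 4))))).support : Set (P 4 K)))) := by
  haveI : IsIso (CommRingCat.ofHom (Θⱼ : A 4 K →+* A 4 K)) := (inferInstance : IsIso Θⱼ.toRingEquiv.toCommRingCatIso.hom)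
  haveI : IsProper π := hπ.isProper
  haveI : IsLocallyNoetherian W := LocallyOfFiniteType.isLocallyNoetherian π
  have hnear := hasSNCWith_transform_boundary_globalCentre_of_good hj hbj hF hclean h0j hsj hπ hperm hread hperm' ms c hc hgood
  rw [MarkedIdeal.transform_boundary] at hnear ⊢
  rw [List.map_append, List.append_assoc]
  refine HasSNCWith.of_disjoint hnear ?_ fun D hD hDn => ?_
  · rw [← List.append_assoc, ← List.map_append]
    exact (hasSNCWith_nearFar_𝓘Λ (K := K) (S := S) ms fs c d hdis j).hasSNC_transform hπ
  · rcases List.mem_append.mp hD with hD | hD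
    · exact absurd (List.mem_append.mpr (Or.inl hD)) hDn
    rcases List.mem_append.mp hD with hD | hD
    · obtain ⟨_, hD', rfl⟩ := List.mem_map.mp hD
      obtain ⟨i, hi, rfl⟩ := List.mem_map.mp hD'
      exact support_strictTransform_far_inter_support_globalCentre hj hjS' hbj hsj hπ (hfs i hi).1 (hfs i hi).2
    · exact absurd (List.mem_append.mpr (Or.inr hD)) hDn

/-- **SECOND GOOD CASE WITH FAR MEMBERS (`j ∈ S'`)**: as `hasSNCWith_transform_boundary_globalCentre_of_good_shear` (`j ∉ ms`, one old
index `m` exempt), with far members on `fs` as above. -/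
theorem hasSNCWith_transform_boundary_globalCentre_of_good_shear_far [IsAlgClosed K] (hj : j ∈ S) (hjS' : j ∈ S') (hbj : b j = 0)
    (hF : F ≠ 0) (hclean : HauserPerlega.IsClean p F) (h0j : Θⱼ (X 0) = X 0 + rename Fin.succ h)
    (hsj : ∀ i : Fin 4, Θⱼ (X i.succ) = X i.succ + C (b i))
    (hπ : IsBlowup π (AffineCoordBlowup.𝓘Λ 4 K (insert 0 (Fin.succ '' (S : Set (Fin 4))))))
    (hperm : (p : ℕ∞) ≤ CentreBlowup.ordAlong S F)
    (hread : Θⱼ (coordBlowupSubst K (insert 0 (Fin.succ '' (S : Set (Fin 4)))) j.succ (hyp p F)) = X j.succ ^ p * hyp p F₁)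
    (hperm' : (p : ℕ∞) ≤ CentreBlowup.ordAlong S' F₁) (ms fs : List (Fin 4)) (hjms : j ∉ ms) (c d : Fin 4 → K)
    (hc : ∀ i ∈ S, c i = 0) (hfs : ∀ i ∈ fs, i ∈ S ∧ d i ≠ 0) (hdis : ∀ i ∈ fs, i ∉ ms)
    (hgood : ∀ i ∈ ms, i ∈ S → i ∈ S' → i ≠ j → i ≠ m → b i = 0) :
    haveI : IsIso (CommRingCat.ofHom (Θⱼ : A 4 K →+* A 4 K)) := (inferInstance : IsIso Θⱼ.toRingEquiv.toCommRingCatIso.hom)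
    HasSNCWith
      ((⟨hypSheaf p F, (ms.map fun i => ofIdealTop (Ideal.span {(γ 4 K).symm (X i.succ + C (c i))})) ++
          fs.map fun i => ofIdealTop (Ideal.span {(γ 4 K).symm (X i.succ + C (d i))}), p⟩ :
          MarkedIdeal (P 4 K)).transform π (AffineCoordBlowup.𝓘Λ 4 K (insert 0 (Fin.succ '' (S : Set (Fin 4)))))).boundary
      (vanishingIdeal (closureImage
        (Spec.map (CommRingCat.ofHom (Θⱼ : A 4 K →+* A 4 K)) ≫ AffineCoordBlowup.chartImm hπ (succ_mem_centreVars hj))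
        ((AffineCoordBlowup.𝓘Λ 4 K (insert 0 (Fin.succ '' (S' : Set (Fin 4))))).support : Set (P 4 K)))) := by
  haveI : IsIso (CommRingCat.ofHom (Θⱼ : A 4 K →+* A 4 K)) := (inferInstance : IsIso Θⱼ.toRingEquiv.toCommRingCatIso.hom)
  haveI : IsProper π := hπ.isProper
  haveI : IsLocallyNoetherian W := LocallyOfFiniteType.isLocallyNoetherian π
  have hnear := hasSNCWith_transform_boundary_globalCentre_of_good_shear hj hbj hF hclean h0j hsj hπ hperm hread hperm' ms hjms c
    hc hgood
  rw [MarkedIdeal.transform_boundary] at hnear ⊢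
  rw [List.map_append, List.append_assoc]
  refine HasSNCWith.of_disjoint hnear ?_ fun D hD hDn => ?_
  · rw [← List.append_assoc, ← List.map_append]
    exact (hasSNCWith_nearFar_𝓘Λ (K := K) (S := S) ms fs c d hdis j).hasSNC_transform hπ
  · rcases List.mem_append.mp hD with hD | hD
    · exact absurd (List.mem_append.mpr (Or.inl hD)) hDn
    rcases List.mem_append.mp hD with hD | hD
    · obtain ⟨_, hD', rfl⟩ := List.mem_map.mp hD
      obtain ⟨i, hi, rfl⟩ := List.mem_map.mp hD'
      exact support_strictTransform_far_inter_support_globalCentre hj hjS' hbj hsj hπ (hfs i hi).1 (hfs i hi).2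
    · exact absurd (List.mem_append.mpr (Or.inr hD)) hDn

end ChartDictionary

end Summit.ResolutionOfSingularities.ResolutionOfSingularities.Theorems.PIDim4

end
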